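import Literature.Topology.FourManifolds.FramedSphereFamilyTwist
import Literature.Topology.FourManifolds.StableRangeGLPeel
import Mathlib.Analysis.CStarAlgebra.Matrix
import Mathlib.Analysis.Calculus.ContDiff.Operations
import HarnessLib

/-!
# Cylinder frames of a spherical modification, IV: choosing the re-framing

Topic `Literature/Topology/FourManifolds` (fact seat of
`Literature.Topology.FourManifolds.HomotopySphere.boundsContractible_of_nullCobordism_isStablyParallelizable_four`;
towards Kervaire–Milnor's Lemma 5.4 / 6.2).  Pure matrix topology feeding `FramedSphereFamily.twist`:

* `FramedSphereFamily.TwistData.ofInvertible` — twisting data from ONE smooth family of invertible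
  operators `a : Sᵏ → GL(ℝᵐ)` (the inverse family `u ↦ (a u)⁻¹` is automatically smooth:
  inversion is smooth on invertible operators, Mathlib's
  `ContinuousLinearMap.IsInvertible.contDiffAt_map_inverse`);
* `FramedSphereFamily.TwistData.ofMatrix` — the same from a smooth field of invertible matrices
  (`Matrix.toEuclideanCLM`);
* `StableFrames.NzMat.castEq` — transport of invertible matrices along `Fin a = Fin b`
  (`Matrix.reindex (finCongr _)`, values of indices preserved), with continuity;
* `StableFrames.NzMat.stabPow_apply_*` — the entries of the iterated stabilisation `1_j ⊕ A`.

Everything is proved; the `def`s are explicit; no named facts.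

## References

* M. Kervaire, J. Milnor, *Groups of homotopy spheres I*, Ann. of Math. (2) 77 (1963), §6,
  Lemmas 6.1–6.2, pp. 520–522. doi:10.2307/1970128 [KervaireMilnorAnnals1963]
* N. Steenrod, *The Topology of Fibre Bundles* (1951), §38. [Steenrod1951]
-/

noncomputable section

open scoped Manifold ContDiff Topology Matrix
open Set Function Metric Module

namespace Literature.Topology.FourManifolds

/-! ### Twisting data from one smooth family of invertible operators -/

namespace FramedSphereFamily.TwistData

attribute [local instance] fact_finrank_euclideanSpace_succ

variable {k m : ℕ}

/-- **Twisting data from a smooth family of invertible operators**: the inverse family is smooth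
because inversion is smooth on the open set of invertible operators. [folklore] -/
def ofInvertible (a : Metric.sphere (0 : EuclideanSpace ℝ (Fin (k + 1))) 1 →
      (EuclideanSpace ℝ (Fin m) →L[ℝ] EuclideanSpace ℝ (Fin m)))
    (ha : ContMDiff (𝓡 k) 𝓘(ℝ, EuclideanSpace ℝ (Fin m) →L[ℝ] EuclideanSpace ℝ (Fin m)) ∞ a)
    (hinv : ∀ u, (a u).IsInvertible) : TwistData k m where
  a := a
  b := fun u => (a u).inverse
  contMDiff_a := ha
  contMDiff_b := fun u => ((hinv u).contDiffAt_map_inverse.contMDiffAt).comp u (ha u)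
  a_b := fun u w => by
    obtain ⟨e, he⟩ := hinv u
    rw [← he, ContinuousLinearMap.inverse_equiv]
    simp
  b_a := fun u w => by
    obtain ⟨e, he⟩ := hinv u
    rw [← he, ContinuousLinearMap.inverse_equiv]
    simp

/-- The operators of `ofInvertible`. [folklore] -/
@[simp] theorem ofInvertible_a (a : Metric.sphere (0 : EuclideanSpace ℝ (Fin (k + 1))) 1 →
      (EuclideanSpace ℝ (Fin m) →L[ℝ] EuclideanSpace ℝ (Fin m)))
    (ha : ContMDiff (𝓡 k) 𝓘(ℝ, EuclideanSpace ℝ (Fin m) →L[ℝ] EuclideanSpace ℝ (Fin m)) ∞ a)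
    (hinv : ∀ u, (a u).IsInvertible) : (ofInvertible a ha hinv).a = a := rfl

/-- **Twisting data from a smooth field of invertible matrices** `α : Sᵏ → GL_m(ℝ)` (entries
smooth), acting on `ℝᵐ` by `Matrix.toEuclideanCLM` (`x ↦ α *ᵥ x`).
[cite: KervaireMilnorAnnals1963, §6 p. 520] -/
def ofMatrix (α : Metric.sphere (0 : EuclideanSpace ℝ (Fin (k + 1))) 1 → Matrix (Fin m) (Fin m) ℝ)
    (hα : ∀ i j, ContMDiff (𝓡 k) 𝓘(ℝ) ∞ fun u => α u i j) (hdet : ∀ u, (α u).det ≠ 0) : TwistData k m :=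
  ofInvertible (fun u => Matrix.toEuclideanCLM (n := Fin m) (𝕜 := ℝ) (α u))
    (by
      -- `toEuclideanCLM (α u) = ∑ᵢⱼ αᵢⱼ(u) • toEuclideanCLM (Eᵢⱼ)`: smooth coefficients, constant vectors
      have hsum : (fun u => Matrix.toEuclideanCLM (n := Fin m) (𝕜 := ℝ) (α u)) = fun u =>
          ∑ i : Fin m, ∑ j : Fin m, α u i j • Matrix.toEuclideanCLM (n := Fin m) (𝕜 := ℝ)
            (Matrix.single i j (1 : ℝ)) := by
        funext u
        conv_lhs => rw [Matrix.matrix_eq_sum_single (α u)]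
        rw [map_sum]
        refine Finset.sum_congr rfl fun i _ => ?_
        rw [map_sum]
        refine Finset.sum_congr rfl fun j _ => ?_
        rw [← map_smul, Matrix.smul_single, smul_eq_mul, mul_one]
      rw [hsum]
      refine ContMDiff.sum fun i _ => ContMDiff.sum fun j _ => ?_
      exact (hα i j).smul contMDiff_const)
    (fun u => by
      have hu : IsUnit (α u).det := Ne.isUnit (hdet u)
      refine ContinuousLinearMap.IsInvertible.of_inverse
        (g := Matrix.toEuclideanCLM (n := Fin m) (𝕜 := ℝ) (α u)⁻¹) ?_ ?_
      · rw [← ContinuousLinearMap.mul_def, ← map_mul, Matrix.mul_nonsing_inv _ hu, map_one]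
        rfl
      · rw [← ContinuousLinearMap.mul_def, ← map_mul, Matrix.nonsing_inv_mul _ hu, map_one]
        rfl)

/-- The operators of `ofMatrix` act by `mulVec`. [folklore] -/
theorem ofMatrix_a_apply (α : Metric.sphere (0 : EuclideanSpace ℝ (Fin (k + 1))) 1 → Matrix (Fin m) (Fin m) ℝ)
    (hα : ∀ i j, ContMDiff (𝓡 k) 𝓘(ℝ) ∞ fun u => α u i j) (hdet : ∀ u, (α u).det ≠ 0)
    (u : Metric.sphere (0 : EuclideanSpace ℝ (Fin (k + 1))) 1) (x : EuclideanSpace ℝ (Fin m)) :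
    (ofMatrix α hα hdet).a u x = WithLp.toLp 2 ((α u).mulVec (WithLp.ofLp x)) := rfl

end FramedSphereFamily.TwistData

/-! ### Transport of invertible matrices along `Fin a = Fin b`, inverses, entries of `stabPow` -/

namespace StableFrames.NzMat

attribute [local instance] fact_finrank_euclideanSpace_succ

variable {X : Type*} [TopologicalSpace X]

/-- **Size cast** of invertible matrices along an equality of sizes (`Matrix.reindex (finCongr e)`;
the values of the indices are preserved). [folklore] -/
def castEq {a b : ℕ} (e : a = b) (A : NzMat a) : NzMat b :=
  ⟨A.1.reindex (finCongr e) (finCongr e), by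
    rw [Matrix.det_reindex_self]; exact A.2⟩

/-- Entries of the size cast. [folklore] -/
@[simp] theorem castEq_val_apply {a b : ℕ} (e : a = b) (A : NzMat a) (i j : Fin b) :
    (castEq e A).1 i j = A.1 (Fin.cast e.symm i) (Fin.cast e.symm j) := rfl

/-- The size cast is continuous. [folklore] -/
theorem continuous_castEq {a b : ℕ} (e : a = b) : Continuous (castEq (e := e)) := by
  refine Continuous.subtype_mk ?_ _
  refine continuous_pi fun i => continuous_pi fun j => ?_
  change Continuous fun A : NzMat a => A.1 (Fin.cast e.symm i) (Fin.cast e.symm j)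
  exact ((continuous_apply _).comp ((continuous_apply _).comp continuous_val))

/-- `castEq e.symm ∘ castEq e = id`. [folklore] -/
@[simp] theorem castEq_symm_castEq {a b : ℕ} (e : a = b) (A : NzMat a) : castEq e.symm (castEq e A) = A := by
  apply Subtype.ext; ext i j; rfl

/-- The size cast on maps. [folklore] -/
def castEqMap {a b : ℕ} (e : a = b) (γ : C(X, NzMat a)) : C(X, NzMat b) :=
  ⟨fun x => castEq e (γ x), (continuous_castEq e).comp γ.2⟩

/-- Values of `castEqMap`. [folklore] -/
@[simp] theorem castEqMap_apply {a b : ℕ} (e : a = b) (γ : C(X, NzMat a)) (x : X) :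
    castEqMap e γ x = castEq e (γ x) := rfl

/-- The size cast preserves homotopy. [folklore] -/
theorem homotopic_castEqMap {a b : ℕ} (e : a = b) {γ γ' : C(X, NzMat a)} (hγ : γ.Homotopic γ') :
    (castEqMap e γ).Homotopic (castEqMap e γ') := by
  have h1 : castEqMap e γ = (⟨castEq e, continuous_castEq e⟩ : C(NzMat a, NzMat b)).comp γ := rfl
  have h2 : castEqMap e γ' = (⟨castEq e, continuous_castEq e⟩ : C(NzMat a, NzMat b)).comp γ' := rfl
  rw [h1, h2]
  exact ContinuousMap.Homotopic.comp (ContinuousMap.Homotopic.refl _) hγ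

/-- **Inversion** of invertible matrices, as a continuous self-map of `NzMat M`. [folklore] -/
def invMap (M : ℕ) : C(NzMat M, NzMat M) :=
  ⟨fun A => ⟨A.1⁻¹, by
      rw [Matrix.det_nonsing_inv, Ring.inverse_eq_inv']
      exact inv_ne_zero A.2⟩,
    by
      refine Continuous.subtype_mk ?_ _
      have := (continuousOn_matrix_inv (n := Fin M)).comp_continuous continuous_val fun A => A.2
      exact this⟩

/-- Values of `invMap`. [folklore] -/
@[simp] theorem invMap_apply_val {M : ℕ} (A : NzMat M) : (invMap M A).1 = A.1⁻¹ := rfl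

/-- Inverses of homotopic maps are homotopic. [folklore] -/
theorem homotopic_inv {M : ℕ} {f g : C(X, NzMat M)} (h : f.Homotopic g) :
    ((invMap M).comp f).Homotopic ((invMap M).comp g) :=
  ContinuousMap.Homotopic.comp (ContinuousMap.Homotopic.refl _) h

/-- `f⁻¹ · f = 1`. [folklore] -/
theorem inv_mul_self {M : ℕ} (f : C(X, NzMat M)) : (invMap M).comp f * f = 1 := by
  ext x : 1
  apply Subtype.ext
  change (f x).1⁻¹ * (f x).1 = 1
  exact Matrix.nonsing_inv_mul _ (Ne.isUnit (f x).2)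

/-- **Entries of the iterated stabilisation, lower-right block**: `(1_t ⊕ A)_{i+t, j+t} = A_{ij}`.
[folklore] -/
theorem stabPow_val_addNat {m : ℕ} (A : NzMat m) : ∀ (t : ℕ) (i j : Fin m),
    (stabPow t A).1 (i.addNat t) (j.addNat t) = A.1 i j
  | 0, i, j => rfl
  | t + 1, i, j => by
    rw [stabPow_succ]
    have hi : (i.addNat (t + 1) : Fin (m + t + 1)) = (i.addNat t).succ := Fin.ext (by simp; omega)
    have hj : (j.addNat (t + 1) : Fin (m + t + 1)) = (j.addNat t).succ := Fin.ext (by simp; omega)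
    rw [hi, hj]
    change SOTransport.blockSucc (stabPow t A).1 (i.addNat t).succ (j.addNat t).succ = A.1 i j
    rw [SOTransport.blockSucc_succ_succ]
    exact stabPow_val_addNat A t i j

/-- **Entries of the iterated stabilisation, first rows**: for `p < t`, row `p` of `1_t ⊕ A` is
that of the identity. [folklore] -/
theorem stabPow_val_of_lt_left {m : ℕ} (A : NzMat m) : ∀ (t : ℕ) (p q : Fin (m + t)), p.1 < t →
    (stabPow t A).1 p q = if p = q then 1 else 0
  | 0, p, q, hp => absurd hp (Nat.not_lt_zero _)
  | t + 1, p, q, hp => by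
    rw [stabPow_succ]
    change SOTransport.blockSucc (stabPow t A).1 p q = _
    refine Fin.cases ?_ (fun p' => ?_) p hp <;> refine Fin.cases ?_ (fun q' => ?_) q
    · intro _; simp
    · intro _; rw [SOTransport.blockSucc_zero_succ]; simp [(Fin.succ_ne_zero q').symm]
    · intro _; rw [SOTransport.blockSucc_succ_zero]; simp [Fin.succ_ne_zero]
    · intro hp'
      rw [SOTransport.blockSucc_succ_succ, stabPow_val_of_lt_left A t p' q' (by simpa using hp')]
      simp [Fin.succ_inj]

/-- **Entries of the iterated stabilisation, first columns**: for `q < t`, column `q` of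
`1_t ⊕ A` is that of the identity. [folklore] -/
theorem stabPow_val_of_lt_right {m : ℕ} (A : NzMat m) : ∀ (t : ℕ) (p q : Fin (m + t)), q.1 < t →
    (stabPow t A).1 p q = if p = q then 1 else 0
  | 0, p, q, hq => absurd hq (Nat.not_lt_zero _)
  | t + 1, p, q, hq => by
    rw [stabPow_succ]
    change SOTransport.blockSucc (stabPow t A).1 p q = _
    refine Fin.cases ?_ (fun q' => ?_) q hq <;> refine Fin.cases ?_ (fun p' => ?_) p
    · intro _; simp
    · intro _; rw [SOTransport.blockSucc_succ_zero]; simp [Fin.succ_ne_zero]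
    · intro _; rw [SOTransport.blockSucc_zero_succ]; simp [(Fin.succ_ne_zero q').symm]
    · intro hq'
      rw [SOTransport.blockSucc_succ_succ, stabPow_val_of_lt_right A t p' q' (by simpa using hq')]
      simp [Fin.succ_inj]

/-- **The choice of the re-framing, matrix part** (Kervaire–Milnor 1963, Lemma 6.2 via the
stable-range surjectivity `π_k(SO_{l+1}) → π_k(SO_{n+2})`, `k < l + 1`): every continuous
`β : Sᵏ → GL_{n+2}(ℝ)` is homotopic to `u ↦ 1_{k+1} ⊕ α(u)` (sizes matched along
`(l + 1) + (k + 1) = n + 2`) for a SMOOTH field `α` of invertible `(l+1) × (l+1)` matrices.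
[cite: KervaireMilnorAnnals1963, Lemma 6.2 (p. 522)] [cite: Steenrod1951, §38] -/
theorem exists_smooth_stabPow_homotopic {k l N : ℕ} (hk : k < l + 1) (e : l + 1 + (k + 1) = N)
    (β : C(Metric.sphere (0 : EuclideanSpace ℝ (Fin (k + 1))) 1, NzMat N)) :
    ∃ (α : Metric.sphere (0 : EuclideanSpace ℝ (Fin (k + 1))) 1 → Matrix (Fin (l + 1)) (Fin (l + 1)) ℝ)
      (hdet : ∀ u, (α u).det ≠ 0), (∀ i j, ContMDiff (𝓡 k) 𝓘(ℝ) ∞ fun u => α u i j) ∧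
      ∃ hc : Continuous fun u => (⟨α u, hdet u⟩ : NzMat (l + 1)),
        β.Homotopic (castEqMap e (stabPowMap (k + 1) ⟨_, hc⟩)) := by
  obtain ⟨α₀, hα₀⟩ := exists_homotopic_stabPow hk (k + 1) (castEqMap e.symm β)
  obtain ⟨α, hdet, hsm, hc, hαα⟩ := exists_contMDiff_homotopic α₀
  refine ⟨α, hdet, hsm, hc, ?_⟩
  -- `β = cast (cast⁻¹ β) ≃ cast (stabPow α₀) ≃ cast (stabPow α)`
  have h1 : β = castEqMap e (castEqMap e.symm β) := by
    ext u : 1; simp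
  have h2 : (stabPowMap (k + 1) α₀).Homotopic (stabPowMap (k + 1) ⟨_, hc⟩) := by
    have : ∀ γ : C(Metric.sphere (0 : EuclideanSpace ℝ (Fin (k + 1))) 1, NzMat (l + 1)),
        stabPowMap (k + 1) γ = (⟨stabPow (k + 1), continuous_stabPow (k + 1)⟩ :
          C(NzMat (l + 1), NzMat (l + 1 + (k + 1)))).comp γ := fun γ => rfl
    rw [this, this]
    exact ContinuousMap.Homotopic.comp (ContinuousMap.Homotopic.refl _) hαα
  rw [h1]
  exact homotopic_castEqMap e (hα₀.trans h2)

end StableFrames.NzMat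

end Literature.Topology.FourManifolds

end
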